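import Summits.QuantumAdvantage.QuantumAdvantage.Theorems.CharDialMaskDialA
import Summits.QuantumAdvantage.QuantumAdvantage.Theorems.CharDialNullDialA
import HarnessLib

/-!
# The mask dial, part B: the adaptive TILING by masked pieces (decomp-qadv lens-6 g18 «NullDial» REV2, tree part 31D)

Port of tree part 30O (`BlockDial.cblk`/`Bset`/`mix`/`sum_card_Bset`) from constant `p`-blocks to MASKED blocks `zblk ℓ S Z k = [S k, S k + ℓ) ∩ Z`
(part 31C): the free blocks of an input `u` are the masked blocks on which `u` is constant (`cblkZ`), the piece map `BsetZ u w` re-sets every free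
masked block `k` to the constant `w k`, `mixZ` is the complementary coordinate of the piece involution, and `sum_card_BsetZ` is the double count
«every input is hit exactly `2^M` times».  Span-based facts are cited from 30M by name (`inBlk_unique`).
Supports item stmt-QuantumAdvantage-32604 (`CharDial.WalkHardFJLinOdd`); source: pub annex g18/OrbitDial38.lean REV2 (sha256 7aeccba348e162ea…) §38f, namespace `…Theses.OrbitDial.MaskDial`,
statements and proofs verbatim (Prop-free).
-/

set_option autoImplicit false

namespace Summit.QuantumAdvantage.AdviceFreeQNC0.JLinPeel.MaskDial

open Finset
open Summit.QuantumAdvantage.AdviceFreeQNC0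
open Summit.QuantumAdvantage.AdviceFreeQNC0.JLinPeel.BlockDial
open Literature.Computability.MetaComplexity Literature.Computability.MetaComplexity.Smolensky

section MaskTiling
open Classical
variable {n M : ℕ} {ℓ m : ℕ} {S : Fin M → ℕ} {Z : Finset (Fin n)}

/-- a coordinate lies in at most one masked block. -/
theorem zblk_unique (h : ((∀ k k', k < k' → S k + ℓ ≤ S k') ∧ (∀ k, S k + ℓ ≤ n))) {k k' : Fin M} {i : Fin n}
    (hi : i ∈ zblk ℓ S Z k) (hi' : i ∈ zblk ℓ S Z k') : k = k' :=
  inBlk_unique h (mem_zblk.mp hi).1 (mem_zblk.mp hi').1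

/-- the FREE masked blocks of `u`: those on which `u` is constant. -/
noncomputable def cblkZ (ℓ : ℕ) (S : Fin M → ℕ) (Z : Finset (Fin n)) (u : Fin n → Bool) : Finset (Fin M) :=
  univ.filter fun k => (∀ x₁ ∈ zblk ℓ S Z k, ∀ x₂ ∈ zblk ℓ S Z k, u x₁ = u x₂)

/-- the bit carried by the masked block `k` of `u` (meaningful when the block is constant). -/
noncomputable def bvZ (ℓ : ℕ) (S : Fin M → ℕ) (Z : Finset (Fin n)) (u : Fin n → Bool) (k : Fin M) : Bool :=
  decide (∀ i ∈ zblk ℓ S Z k, u i = true)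

/-- the PIECE MAP: re-set every free masked block `k` of `u` to the constant `w k`; everything else stays. -/
noncomputable def BsetZ (ℓ : ℕ) (S : Fin M → ℕ) (Z : Finset (Fin n)) (u : Fin n → Bool) (w : Fin M → Bool) : Fin n → Bool := fun i =>
  if h : ∃ k, i ∈ zblk ℓ S Z k ∧ (∀ x₁ ∈ zblk ℓ S Z k, ∀ x₂ ∈ zblk ℓ S Z k, u x₁ = u x₂) then w h.choose else u i

/-- the complementary coordinates of the piece involution. -/
noncomputable def mixZ (ℓ : ℕ) (S : Fin M → ℕ) (Z : Finset (Fin n)) (u : Fin n → Bool) (w : Fin M → Bool) : Fin M → Bool := fun k =>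
  if (∀ x₁ ∈ zblk ℓ S Z k, ∀ x₂ ∈ zblk ℓ S Z k, u x₁ = u x₂) then bvZ ℓ S Z u k else w k

/-- on a free masked block `k` the piece point carries the bit `w k`. -/
theorem BsetZ_of_const (h : ((∀ k k', k < k' → S k + ℓ ≤ S k') ∧ (∀ k, S k + ℓ ≤ n))) (u : Fin n → Bool) (w : Fin M → Bool) {k : Fin M}
    {i : Fin n} (hki : i ∈ zblk ℓ S Z k) (hc : (∀ x₁ ∈ zblk ℓ S Z k, ∀ x₂ ∈ zblk ℓ S Z k, u x₁ = u x₂)) : BsetZ ℓ S Z u w i = w k := by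
  unfold BsetZ
  have hex : ∃ k, i ∈ zblk ℓ S Z k ∧ (∀ x₁ ∈ zblk ℓ S Z k, ∀ x₂ ∈ zblk ℓ S Z k, u x₁ = u x₂) := ⟨k, hki, hc⟩
  rw [dif_pos hex, zblk_unique h hex.choose_spec.1 hki]

/-- off the free masked blocks the piece point agrees with `u`. -/
theorem BsetZ_of_not (u : Fin n → Bool) (w : Fin M → Bool) {i : Fin n}
    (hx : ¬ ∃ k, i ∈ zblk ℓ S Z k ∧ (∀ x₁ ∈ zblk ℓ S Z k, ∀ x₂ ∈ zblk ℓ S Z k, u x₁ = u x₂)) : BsetZ ℓ S Z u w i = u i := by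
  unfold BsetZ
  rw [dif_neg hx]

/-- on a NON-free masked block the piece point agrees with `u`. -/
theorem BsetZ_of_not_const (h : ((∀ k k', k < k' → S k + ℓ ≤ S k') ∧ (∀ k, S k + ℓ ≤ n))) (u : Fin n → Bool) (w : Fin M → Bool) {k : Fin M}
    {i : Fin n} (hki : i ∈ zblk ℓ S Z k) (hc : ¬ (∀ x₁ ∈ zblk ℓ S Z k, ∀ x₂ ∈ zblk ℓ S Z k, u x₁ = u x₂)) : BsetZ ℓ S Z u w i = u i := by
  refine BsetZ_of_not u w fun ⟨k', hk', hc'⟩ => hc ?_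
  rw [zblk_unique h hki hk']
  exact hc'

/-- the piece map preserves which masked blocks are free. -/
theorem isConst_BsetZ (h : ((∀ k k', k < k' → S k + ℓ ≤ S k') ∧ (∀ k, S k + ℓ ≤ n))) (u : Fin n → Bool) (w : Fin M → Bool) (k : Fin M) :
    (∀ x₁ ∈ zblk ℓ S Z k, ∀ x₂ ∈ zblk ℓ S Z k, (BsetZ ℓ S Z u w) x₁ = (BsetZ ℓ S Z u w) x₂)
      ↔ (∀ x₁ ∈ zblk ℓ S Z k, ∀ x₂ ∈ zblk ℓ S Z k, u x₁ = u x₂) := by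
  constructor
  · intro hc
    by_contra hnc
    apply hnc
    intro i hi i' hi'
    have e := hc i hi i' hi'
    rwa [BsetZ_of_not_const h u w hi hnc, BsetZ_of_not_const h u w hi' hnc] at e
  · intro hc i hi i' hi'
    rw [BsetZ_of_const h u w hi hc, BsetZ_of_const h u w hi' hc]

/-- masked blocks of size `m ≥ 1` are non-empty. -/
theorem exists_inZ (hm : ∀ k, (zblk ℓ S Z k).card = m) (hm1 : 1 ≤ m) (k : Fin M) : ∃ i : Fin n, i ∈ zblk ℓ S Z k := by
  have hne : (zblk ℓ S Z k).Nonempty := by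
    rw [← Finset.card_pos, hm k]
    exact hm1
  exact hne

/-- on a free masked block the carried bit is the value. -/
theorem bvZ_eq_of_const {u : Fin n → Bool} {k : Fin M} {i : Fin n} (hki : i ∈ zblk ℓ S Z k)
    (hc : (∀ x₁ ∈ zblk ℓ S Z k, ∀ x₂ ∈ zblk ℓ S Z k, u x₁ = u x₂)) : bvZ ℓ S Z u k = u i := by
  unfold bvZ
  cases hu : u i
  · rw [decide_eq_false_iff_not]
    intro hall
    have := hall i hki
    rw [hu] at this
    exact Bool.false_ne_true this
  · rw [decide_eq_true_iff]
    intro i' hi'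
    rw [← hu]
    exact hc i' hi' i hki

/-- the piece involution, first coordinate. -/
theorem BsetZ_BsetZ_mixZ (h : ((∀ k k', k < k' → S k + ℓ ≤ S k') ∧ (∀ k, S k + ℓ ≤ n))) (u : Fin n → Bool) (w : Fin M → Bool) :
    BsetZ ℓ S Z (BsetZ ℓ S Z u w) (mixZ ℓ S Z u w) = u := by
  funext i
  by_cases hx : ∃ k, i ∈ zblk ℓ S Z k ∧ (∀ x₁ ∈ zblk ℓ S Z k, ∀ x₂ ∈ zblk ℓ S Z k, u x₁ = u x₂)
  · obtain ⟨k, hki, hc⟩ := hx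
    rw [BsetZ_of_const h _ _ hki ((isConst_BsetZ h u w k).mpr hc), mixZ, if_pos hc, bvZ_eq_of_const hki hc]
  · have hx' : ¬ ∃ k, i ∈ zblk ℓ S Z k ∧ (∀ x₁ ∈ zblk ℓ S Z k, ∀ x₂ ∈ zblk ℓ S Z k, (BsetZ ℓ S Z u w) x₁ = (BsetZ ℓ S Z u w) x₂) := by
      rintro ⟨k, hki, hc⟩
      exact hx ⟨k, hki, (isConst_BsetZ h u w k).mp hc⟩
    rw [BsetZ_of_not _ _ hx', BsetZ_of_not _ _ hx]

/-- the piece involution, second coordinate. -/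
theorem mixZ_BsetZ_mixZ (h : ((∀ k k', k < k' → S k + ℓ ≤ S k') ∧ (∀ k, S k + ℓ ≤ n))) (hm : ∀ k, (zblk ℓ S Z k).card = m) (hm1 : 1 ≤ m)
    (u : Fin n → Bool) (w : Fin M → Bool) :
    mixZ ℓ S Z (BsetZ ℓ S Z u w) (mixZ ℓ S Z u w) = w := by
  funext k
  unfold mixZ
  by_cases hc : (∀ x₁ ∈ zblk ℓ S Z k, ∀ x₂ ∈ zblk ℓ S Z k, u x₁ = u x₂)
  · obtain ⟨i, hki⟩ := exists_inZ hm hm1 k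
    rw [if_pos ((isConst_BsetZ h u w k).mpr hc), bvZ_eq_of_const hki ((isConst_BsetZ h u w k).mpr hc),
      BsetZ_of_const h u w hki hc]
  · have hc' : ¬ (∀ x₁ ∈ zblk ℓ S Z k, ∀ x₂ ∈ zblk ℓ S Z k, (BsetZ ℓ S Z u w) x₁ = (BsetZ ℓ S Z u w) x₂) :=
      fun hh => hc ((isConst_BsetZ h u w k).mp hh)
    rw [if_neg hc', if_neg hc]

/-- **TILING BY MASKED PIECES (double counting)**: summing, over all inputs `u`, the number of piece parameters `w` whose piece point has a
property counts every input with the property exactly `2^M` times. -/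
theorem sum_card_BsetZ (h : ((∀ k k', k < k' → S k + ℓ ≤ S k') ∧ (∀ k, S k + ℓ ≤ n))) (hm : ∀ k, (zblk ℓ S Z k).card = m) (hm1 : 1 ≤ m)
    (P : (Fin n → Bool) → Prop) [DecidablePred P] :
    ∑ u : Fin n → Bool, (univ.filter fun w : Fin M → Bool => P (BsetZ ℓ S Z u w)).card
      = 2 ^ M * (univ.filter fun u : Fin n → Bool => P u).card := by
  let Φ : (Fin n → Bool) × (Fin M → Bool) → (Fin n → Bool) × (Fin M → Bool) :=
    fun q => (BsetZ ℓ S Z q.1 q.2, mixZ ℓ S Z q.1 q.2)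
  have hΦ : Function.Involutive Φ := by
    rintro ⟨u, w⟩
    simp only [Φ, Prod.mk.injEq]
    exact ⟨BsetZ_BsetZ_mixZ h u w, mixZ_BsetZ_mixZ h hm hm1 u w⟩
  have h1 : ∀ u : Fin n → Bool, (univ.filter fun w : Fin M → Bool => P (BsetZ ℓ S Z u w)).card
      = ∑ w : Fin M → Bool, (if P (BsetZ ℓ S Z u w) then 1 else 0) := fun u => Finset.card_filter _ _
  simp_rw [h1]
  have h3 : (∑ u : Fin n → Bool, ∑ w : Fin M → Bool, (if P (BsetZ ℓ S Z u w) then 1 else 0))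
      = ∑ q : (Fin n → Bool) × (Fin M → Bool), (if P (BsetZ ℓ S Z q.1 q.2) then 1 else 0) :=
    (Fintype.sum_prod_type' (fun u w => if P (BsetZ ℓ S Z u w) then (1 : ℕ) else 0)).symm
  have h2 := hΦ.bijective.sum_comp (fun q : (Fin n → Bool) × (Fin M → Bool) => if P q.1 then (1 : ℕ) else 0)
  rw [h3]
  rw [show (∑ q : (Fin n → Bool) × (Fin M → Bool), (if P (BsetZ ℓ S Z q.1 q.2) then (1 : ℕ) else 0))
      = ∑ q : (Fin n → Bool) × (Fin M → Bool), (if P q.1 then (1 : ℕ) else 0) from h2]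
  rw [Fintype.sum_prod_type, Finset.card_filter, Finset.mul_sum]
  refine Finset.sum_congr rfl fun u _ => ?_
  show (∑ _w : Fin M → Bool, (if P u then (1 : ℕ) else 0)) = _
  rw [Finset.sum_const, Finset.card_univ, Fintype.card_fun, Fintype.card_bool, Fintype.card_fin, smul_eq_mul]

/-! #### transport of per-piece bounds to the adaptive piece, for any property of inputs -/

-- `sep_sub` is the landed `NullDial.sep_sub` (CharDialNullDialA; identical statement) — imported, not restated (gate dedup pre-empted at landing).

/-- re-indexing the spans re-indexes the masked blocks. -/
theorem zblk_reindex {N : ℕ} (e : Fin N → Fin M) (j : Fin N) : zblk ℓ (fun j => S (e j)) Z j = zblk ℓ S Z (e j) := by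
  ext i
  rw [mem_zblk, mem_zblk]

/-- **piece bounds transported to the cube, for any property `P` of inputs**: if along every increasingly re-indexed sub-family of `> T` masked
blocks the piece through every input has at most `θ·2^N` parameters with property `P`, then so does the adaptive piece `BsetZ u ·` through every `u`
with `> T` free masked blocks (`Subcube.card_filter_merge_le` on the block cube, free blocks re-indexed by `Subcube.emb`). -/
theorem card_BsetZ_le_gen (h : ((∀ k k', k < k' → S k + ℓ ≤ S k') ∧ (∀ k, S k + ℓ ≤ n))) {θ : ℝ} {T : ℕ}
    (P : (Fin n → Bool) → Prop) [DecidablePred P]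
    (hpiece : ∀ (N : ℕ) (e : Fin N → Fin M), StrictMono e → T < N →
      ∀ u : Fin n → Bool, ((univ.filter fun v : Fin N → Bool => P (zset ℓ (fun j => S (e j)) Z u v)).card : ℝ) ≤ θ * (2 : ℝ) ^ N)
    (u : Fin n → Bool) (hT : T < (cblkZ ℓ S Z u).card) :
    ((univ.filter fun w : Fin M → Bool => P (BsetZ ℓ S Z u w)).card : ℝ) ≤ θ * (2 : ℝ) ^ M := by
  set W : Finset (Fin M) := univ \ cblkZ ℓ S Z u with hW
  let a : Fin M → Bool := fun _ => false
  let s' : Fin (M - W.card) → ℕ := fun j => S (Subcube.emb W j)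
  have hWc : W.card + (cblkZ ℓ S Z u).card = M := by
    rw [hW, Finset.card_sdiff_add_card_eq_card (subset_univ _), card_univ, Fintype.card_fin]
  have hMW : M - W.card = (cblkZ ℓ S Z u).card := by omega
  have hmemF : ∀ {k : Fin M}, k ∉ W ↔ (∀ x₁ ∈ zblk ℓ S Z k, ∀ x₂ ∈ zblk ℓ S Z k, u x₁ = u x₂) := by
    intro k
    rw [hW, mem_sdiff, cblkZ, mem_filter]
    simp only [Finset.mem_univ, true_and, not_not]
  have hs' : ((∀ k k', k < k' → s' k + ℓ ≤ s' k') ∧ (∀ k, s' k + ℓ ≤ n)) := Summit.QuantumAdvantage.AdviceFreeQNC0.JLinPeel.NullDial.sep_sub h (Subcube.emb_strictMono W)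
  have hext : ∀ v : Fin (M - W.card) → Bool, BsetZ ℓ S Z u (Subcube.ext W a v) = zset ℓ s' Z u v := by
    intro v
    funext i
    by_cases hx : ∃ k, i ∈ zblk ℓ S Z k ∧ (∀ x₁ ∈ zblk ℓ S Z k, ∀ x₂ ∈ zblk ℓ S Z k, u x₁ = u x₂)
    · obtain ⟨k, hki, hc⟩ := hx
      have hkW : k ∉ W := hmemF.mpr hc
      have hj : (s' (Subcube.idx W k hkW) ≤ i.val ∧ i.val < s' (Subcube.idx W k hkW) + ℓ) := by
        show S (Subcube.emb W (Subcube.idx W k hkW)) ≤ i.val ∧ i.val < S (Subcube.emb W (Subcube.idx W k hkW)) + ℓ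
        rw [Subcube.emb_idx]
        exact (mem_zblk.mp hki).1
      rw [BsetZ_of_const h u _ hki hc, zset_of_in hs' u v hj (mem_zblk.mp hki).2]
      unfold Subcube.ext
      rw [dif_neg hkW]
    · rw [BsetZ_of_not u _ hx, zset_of_out u v fun j hj => hx ⟨Subcube.emb W j, ?_, hmemF.mp (Subcube.emb_not_mem W j)⟩]
      exact mem_zblk.mpr hj
  have hdepW : ∀ w : Fin M → Bool, BsetZ ℓ S Z u (AffBells22.subcubeMerge W a w) = BsetZ ℓ S Z u w := by
    intro w
    funext i
    unfold BsetZ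
    by_cases hx : ∃ k, i ∈ zblk ℓ S Z k ∧ (∀ x₁ ∈ zblk ℓ S Z k, ∀ x₂ ∈ zblk ℓ S Z k, u x₁ = u x₂)
    · rw [dif_pos hx, dif_pos hx]
      unfold AffBells22.subcubeMerge
      rw [if_neg (hmemF.mpr hx.choose_spec.2)]
    · rw [dif_neg hx, dif_neg hx]
  have e1 : (univ.filter fun w : Fin M → Bool => P (BsetZ ℓ S Z u w))
      = univ.filter fun w : Fin M → Bool => P (BsetZ ℓ S Z u (AffBells22.subcubeMerge W a w)) := by
    refine Finset.filter_congr fun w _ => ?_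
    rw [hdepW]
  have e2 : (univ.filter fun v : Fin (M - W.card) → Bool => P (BsetZ ℓ S Z u (Subcube.ext W a v)))
      = univ.filter fun v : Fin (M - W.card) → Bool => P (zset ℓ s' Z u v) := by
    refine Finset.filter_congr fun v _ => ?_
    rw [hext]
  have hmul := Subcube.card_filter_merge_le W a (fun w : Fin M → Bool => P (BsetZ ℓ S Z u w))
  rw [← e1, e2] at hmul
  have hp' := hpiece (M - W.card) (Subcube.emb W) (Subcube.emb_strictMono W) (by rw [hMW]; exact hT) u
  have hpow : (2 : ℝ) ^ W.card * (2 : ℝ) ^ (M - W.card) = (2 : ℝ) ^ M := by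
    rw [← pow_add, Subcube.card_add_sub]
  calc ((univ.filter fun w : Fin M → Bool => P (BsetZ ℓ S Z u w)).card : ℝ)
      ≤ (2 : ℝ) ^ W.card * ((univ.filter fun v : Fin (M - W.card) → Bool => P (zset ℓ s' Z u v)).card : ℝ) := by
        exact_mod_cast hmul
    _ ≤ (2 : ℝ) ^ W.card * (θ * (2 : ℝ) ^ (M - W.card)) := mul_le_mul_of_nonneg_left hp' (by positivity)
    _ = θ * (2 : ℝ) ^ M := by rw [← hpow]; ring

end MaskTiling

end Summit.QuantumAdvantage.AdviceFreeQNC0.JLinPeel.MaskDial
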